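import Mathlib
import Summits.CriticalPhenomena.CardyFormulaZ2.Theorems.CardySelfRefinementRussoDriftPolynomial
import Literature.Probability.Percolation.ProdBernoulliRusso
import Literature.Probability.Percolation.SelfRefinementMeasure
import HarnessLib

/-!
# Russo dictionary at the Bernoulli endpoint `(0, ½)`: `Σ_{e ∈ W} P_{1/2}(e pivotal) ≤ ∂cP(0, ½)`

Crux `stmt-CriticalPhenomena-10269`
(`Summit.CriticalPhenomena.CardyFormulaZ2.Theses.CardySelfRefinement.GradientComparability`),
line **Sketch**, stub `stub_Dc_zero_half_ge_sum_pivotal` (the Russo dictionary feeding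
`divergesAt_zero_half`).  Vocabulary (`ax prm cfg M P Dc window Aloc edgeOf coinWindow …`) from
`CardySelfRefinementDefs`; `M k ρ c` is definitionally the tree's `selfRefinementMeasure k ρ c`
(`prm = refinementParam`, `cfg = refinementConfig` term for term).

## Mathematics

At `ρ = 0` every selector coin has bias `projIcc 0 = 0`, so `prodBernoulli (prm k 0 c)`-a.s. no
selector is on and the read-out `cfg k` coincides with its **monotone shadow**
`S ↦ edgeConfig (ownLayer S)` (every fine edge follows its own coin;
`refinementConfig_eq_edgeConfig_ownLayer`).  Hence for EVERY `c`,
`P k m F η 0 c = (prodBernoulli (prm k 0 c)).real E` with the shadow event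
`E := (edgeConfig ∘ ownLayer) ⁻¹' Aloc m F η`, which is increasing (`Aloc` is increasing, the shadow
is monotone) and determined by the finite coin window `coinWindow k (window m F η)`.  The tree's
monotone multi-parameter Russo formula `hasDerivAt_prodBernoulli_real` then differentiates
`c ↦ P k m F η 0 c` at the interior point `c = ½` (where `Dc`'s `derivWithin` on `[0,1]` is the
plain derivative): the own coin of a non-axial edge has bias `projIcc c = c` near `½`
(derivative `1`), every other bias is constant in `c` (derivative `0`), so
`∂cP(0,½) = Σ_{own coins i of non-axial edges in the window} P(i pivotal for E)`.
Finally, inserting / deleting the own coin `(v,d,0)` commutes with the shadow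
(`edgeOf` is injective), so `{S | (v,d,0) pivotal for E}` is the shadow-preimage of
`{ω | edgeOf (v,d) pivotal for Aloc}`, whose `P_{1/2}`-mass it therefore has
(`selfRefinementMeasure_zero_half`: the shadow pushes `prodBernoulli (prm k 0 ½)` to bond-`ℤ²` at
`½`); edges outside the window are never pivotal for `Aloc`, and the own coins of the edges of
`W ∩ window` are distinct members of the coin window, whence the inequality.
-/

noncomputable section

namespace Summit.CriticalPhenomena.CardyFormulaZ2.Theorems.CardySelfRefinement

open scoped Topology
open Filter Set MeasureTheory
open Literature.Probability.LatticeModels Literature.Probability.Percolation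
open Literature.Probability.Percolation.QuadCrossing
open Summit.CriticalPhenomena.CardyFormulaZ2.Theses.CardySelfRefinement

/-! ## The localised crossing event and its monotone shadow on the coins -/

/-- The tree's edge label `cornerEdge (v,d) = {v, v + e_d}` is the route's `edgeOf (v,d)`. -/
theorem cornerEdge_eq_edgeOf (vd : Site 2 × Fin 2) :
    Literature.Probability.Percolation.cornerEdge vd = edgeOf vd := by
  simp only [Literature.Probability.Percolation.cornerEdge, edgeOf, dirVec,
    Literature.Probability.Percolation.dirVec_eq_single]

/-- The localised joint crossing event `Aloc` is increasing. -/
theorem isUpperSet_Aloc (m : ℕ) (F : Fin m → Quad (Set.univ : Set ℂ)) (η : ℝ) :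
    IsUpperSet (Aloc m F η) := by
  intro ω ω' hle hω
  have hω' : ∀ i, F i ∈ configOf squareLatticeEmbedding.z η Set.univ (ω ∩ window m F η) := hω
  show ∀ i, F i ∈ configOf squareLatticeEmbedding.z η Set.univ (ω' ∩ window m F η)
  exact fun i => configOfSet_mono (D := (Set.univ : Set ℂ))
    (openEdgeRealization_mono' _ η (Set.inter_subset_inter_left _ hle)) (hω' i)

/-- The shadow event `(edgeConfig ∘ ownLayer) ⁻¹' Aloc` is increasing in the coins. -/
theorem isUpperSet_preimage_Aloc_shadow (m : ℕ) (F : Fin m → Quad (Set.univ : Set ℂ)) (η : ℝ) :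
    IsUpperSet ((edgeConfig ∘ ownLayer) ⁻¹' Aloc m F η) := by
  intro S S' hle hS
  have hS' : edgeConfig (ownLayer S) ∈ Aloc m F η := hS
  have hsub : ownLayer S ⊆ ownLayer S' := fun e he => hle he
  show edgeConfig (ownLayer S') ∈ Aloc m F η
  exact isUpperSet_Aloc m F η (show edgeConfig (ownLayer S) ⊆ edgeConfig (ownLayer S') from
    Set.image_mono hsub) hS'

/-- The own coin of an edge of `W` lies in the coin window of `W`. -/
theorem own_mem_coinWindow (k : ℕ) {W : Set (Sym2 (Site 2))} {v : Site 2} {d : Fin 2}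
    (h : edgeOf (v, d) ∈ W) : (v, d, (0 : Fin 3)) ∈ coinWindow k W := by
  rw [coinWindow, Set.mem_iUnion₂]
  exact ⟨(v, d), h, by simp [coinsOf]⟩

/-- The shadow event is determined by the finite coin window (indeed by its own coins). -/
theorem determinedBy_preimage_Aloc_shadow (k m : ℕ) (F : Fin m → Quad (Set.univ : Set ℂ)) (η : ℝ) :
    DeterminedBy ((edgeConfig ∘ ownLayer) ⁻¹' Aloc m F η) (coinWindow k (window m F η)) := by
  rw [determinedBy_iff]
  intro S S' hSS'
  have key : ∀ vd : Site 2 × Fin 2,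
      Literature.Probability.Percolation.cornerEdge vd ∈ window m F η →
        ((vd.1, vd.2, (0 : Fin 3)) ∈ S ↔ (vd.1, vd.2, (0 : Fin 3)) ∈ S') := by
    rintro ⟨v, d⟩ hvd
    rw [cornerEdge_eq_edgeOf] at hvd
    have hi := own_mem_coinWindow k hvd
    exact ⟨fun h => ((Set.ext_iff.1 hSS' _).1 ⟨h, hi⟩).1,
      fun h => ((Set.ext_iff.1 hSS' _).2 ⟨h, hi⟩).1⟩
  have hW : edgeConfig (ownLayer S) ∩ window m F η = edgeConfig (ownLayer S') ∩ window m F η := by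
    ext e
    simp only [Set.mem_inter_iff, edgeConfig_eq_image, Set.mem_image, mem_ownLayer_iff]
    constructor
    · rintro ⟨⟨vd, hvd, rfl⟩, he⟩
      exact ⟨⟨vd, (key vd he).1 hvd, rfl⟩, he⟩
    · rintro ⟨⟨vd, hvd, rfl⟩, he⟩
      exact ⟨⟨vd, (key vd he).2 hvd, rfl⟩, he⟩
  show edgeConfig (ownLayer S) ∩ window m F η ∈ A m F η ↔
    edgeConfig (ownLayer S') ∩ window m F η ∈ A m F η
  rw [hW]

/-- Switching the own coin `(v,d,0)` on switches the edge `edgeOf (v,d)` on in the shadow. -/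
theorem shadow_insert (S : Set (Site 2 × Fin 2 × Fin 3)) (v : Site 2) (d : Fin 2) :
    edgeConfig (ownLayer (insert (v, d, (0 : Fin 3)) S)) =
      insert (edgeOf (v, d)) (edgeConfig (ownLayer S)) := by
  have h : ownLayer (insert (v, d, (0 : Fin 3)) S) = insert (v, d) (ownLayer S) := by
    ext e
    simp [ownLayer, Prod.ext_iff]
  rw [h, edgeConfig_eq_image, edgeConfig_eq_image, Set.image_insert_eq, cornerEdge_eq_edgeOf]

/-- Switching the own coin `(v,d,0)` off switches the edge `edgeOf (v,d)` off in the shadow. -/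
theorem shadow_sdiff (S : Set (Site 2 × Fin 2 × Fin 3)) (v : Site 2) (d : Fin 2) :
    edgeConfig (ownLayer (S \ {(v, d, (0 : Fin 3))})) =
      edgeConfig (ownLayer S) \ {edgeOf (v, d)} := by
  have h : ownLayer (S \ {(v, d, (0 : Fin 3))}) = ownLayer S \ {(v, d)} := by
    ext e
    simp [ownLayer, Prod.ext_iff]
  rw [h, edgeConfig_eq_image, edgeConfig_eq_image,
    Set.image_sdiff Literature.Probability.Percolation.cornerEdge_injective, Set.image_singleton,
    cornerEdge_eq_edgeOf]

/-- Pivotality of the own coin `(v,d,0)` for the shadow event is pivotality of the edge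
`edgeOf (v,d)` for `Aloc`, read through the shadow. -/
theorem preimage_setOf_isPivotal_Aloc (m : ℕ) (F : Fin m → Quad (Set.univ : Set ℂ)) (η : ℝ)
    (v : Site 2) (d : Fin 2) :
    (edgeConfig ∘ ownLayer) ⁻¹' {ω | IsPivotal (Aloc m F η) (edgeOf (v, d)) ω} =
      {S | IsPivotal ((edgeConfig ∘ ownLayer) ⁻¹' Aloc m F η) (v, d, (0 : Fin 3)) S} := by
  ext S
  simp only [Set.mem_preimage, Set.mem_setOf_eq, IsPivotal, Function.comp_apply]
  rw [shadow_insert, shadow_sdiff]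

/-- An edge outside the window is never pivotal for the localised event `Aloc`. -/
theorem setOf_isPivotal_Aloc_eq_empty (m : ℕ) (F : Fin m → Quad (Set.univ : Set ℂ)) (η : ℝ)
    {e : Sym2 (Site 2)} (he : e ∉ window m F η) :
    {ω | IsPivotal (Aloc m F η) e ω} = ∅ := by
  ext ω
  simp only [Set.mem_setOf_eq, Set.mem_empty_iff_false, iff_false]
  have h1 : insert e ω ∈ Aloc m F η ↔ ω ∈ Aloc m F η := by
    show insert e ω ∩ window m F η ∈ A m F η ↔ ω ∩ window m F η ∈ A m F η
    rw [Set.insert_inter_of_notMem he]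
  have h2 : ω \ {e} ∈ Aloc m F η ↔ ω ∈ Aloc m F η := by
    show (ω \ {e}) ∩ window m F η ∈ A m F η ↔ ω ∩ window m F η ∈ A m F η
    rw [Set.sdiff_inter_right_comm, Set.sdiff_singleton_eq_self (fun h => he h.2)]
  rintro (⟨ha, hb⟩ | ⟨ha, hb⟩)
  · exact hb (h2.2 (h1.1 ha))
  · exact hb (h1.2 (h2.1 ha))

/-- The pivotality event of a coordinate for a measurable event is measurable. -/
theorem measurableSet_setOf_isPivotal {α : Type*} {B : Set (Set α)} (hB : MeasurableSet B) (e : α) :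
    MeasurableSet {ω : Set α | IsPivotal B e ω} := by
  have h1 : Measurable fun ω : Set α => insert e ω :=
    measurable_set_iff.2 fun a => show Measurable fun ω : Set α => a = e ∨ a ∈ ω from
      measurable_const.or (measurable_set_mem a)
  have h2 : Measurable fun ω : Set α => ω \ {e} :=
    measurable_set_iff.2 fun a => show Measurable fun ω : Set α => a ∈ ω ∧ ¬ a = e from
      (measurable_set_mem a).and measurable_const
  have h : {ω : Set α | IsPivotal B e ω} =
      symmDiff ((fun ω : Set α => insert e ω) ⁻¹' B) ((fun ω : Set α => ω \ {e}) ⁻¹' B) := by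
    ext ω
    simp only [Set.mem_setOf_eq, IsPivotal, Xor, Set.mem_symmDiff, Set.mem_preimage]
  rw [h]
  exact (h1 hB).symmDiff (h2 hB)

/-! ## At `ρ = 0` the model is the shadow push-forward, for every `c` -/

/-- At `ρ = 0` the read-out `cfg k` is a.s. its monotone shadow `edgeConfig ∘ ownLayer`. -/
theorem cfg_ae_eq_shadow (k : ℕ) (c : ℝ) :
    (cfg k : Set (Site 2 × Fin 2 × Fin 3) → BondConfig (Site 2)) =ᵐ[prodBernoulli (prm k 0 c)]
      (edgeConfig ∘ ownLayer) := by
  filter_upwards [ae_forall_selector_notMem k c] with S hS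
  exact refinementConfig_eq_edgeConfig_ownLayer hS

/-- `M_k(0,c)` is the push-forward of the coins under the shadow. -/
theorem M_zero_eq_map_shadow (k : ℕ) (c : ℝ) :
    M k 0 c = (prodBernoulli (prm k 0 c)).map (edgeConfig ∘ ownLayer) :=
  Measure.map_congr (cfg_ae_eq_shadow k c)

/-- Bond-`ℤ²` at `½` is the shadow push-forward of the coins of `M_k(0,½)`. -/
theorem bondPercolation_half_eq_map_shadow (k : ℕ) :
    bondPercolation (zdGraph 2) half =
      (prodBernoulli (prm k 0 (1 / 2))).map (edgeConfig ∘ ownLayer) := by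
  rw [← selfRefinementMeasure_zero_half k]
  exact M_zero_eq_map_shadow k (1 / 2)

/-- For every `c`, `P k m F η 0 c` is the coin probability of the shadow event. -/
theorem P_zero_eq_real_shadow (k m : ℕ) (F : Fin m → Quad (Set.univ : Set ℂ)) {η : ℝ} (hη : η ≠ 0)
    (c : ℝ) :
    P k m F η 0 c = (prodBernoulli (prm k 0 c)).real ((edgeConfig ∘ ownLayer) ⁻¹' Aloc m F η) := by
  rw [P_eq_real_Aloc, M_zero_eq_map_shadow, map_measureReal_apply
    (measurable_edgeConfig.comp measurable_ownLayer) (measurableSet_Aloc m F hη)]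

/-- The coin biases along `c ↦ prm k 0 c` are differentiable at `c = ½`: derivative `1` for the
own coin of a non-axial edge (bias `projIcc c = c` near `½`), `0` for every other coin (constant
bias). -/
theorem hasDerivAt_coe_prm (k : ℕ) (i : Site 2 × Fin 2 × Fin 3) :
    HasDerivAt (fun b : ℝ => (prm k 0 b i : ℝ))
      (if i.2.2 = 0 ∧ ¬ ax k (i.1, i.2.1) then (1 : ℝ) else 0) (1 / 2) := by
  by_cases h : i.2.2 = 0 ∧ ¬ ax k (i.1, i.2.1)
  · rw [if_pos h]
    have hf : (fun b : ℝ => (prm k 0 b i : ℝ)) =ᶠ[𝓝 (1 / 2 : ℝ)] fun b => b := by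
      have hnhds : Set.Icc (0 : ℝ) 1 ∈ 𝓝 ((1 : ℝ) / 2) := Icc_mem_nhds (by norm_num) (by norm_num)
      filter_upwards [hnhds] with b hb
      simp only [prm, if_pos h.1, if_neg h.2, Set.projIcc_of_mem _ hb]
    exact (hasDerivAt_id' (1 / 2 : ℝ)).congr_of_eventuallyEq hf
  · rw [if_neg h]
    have hf : (fun b : ℝ => (prm k 0 b i : ℝ)) = fun _ => (prm k 0 0 i : ℝ) := by
      funext b
      simp only [prm]
      split_ifs with h0 hax
      · rfl
      · exact absurd ⟨h0, hax⟩ h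
      · rfl
      · rfl
    rw [hf]
    exact hasDerivAt_const _ _

/-! ## The stub -/

/-- **RUSSO DICTIONARY AT THE BERNOULLI ENDPOINT `(0,½)`.**  For every finite family `W` of
non-axial edges, `Σ_{e ∈ W} P_{1/2}(e pivotal for Aloc m F η) ≤ ∂cP(0,½)`: by Russo's formula for
the increasing shadow event, `∂cP(0,½)` is the sum over the own coins of ALL non-axial window edges
of their pivotality probabilities, each of which is the `P_{1/2}`-probability that the edge is
pivotal for `Aloc`; edges outside the window are never pivotal. -/
theorem stub_Dc_zero_half_ge_sum_pivotal (k m : ℕ) (F : Fin m → Quad (Set.univ : Set ℂ)) {η : ℝ}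
    (hη : η ≠ 0) (W : Finset (Sym2 (Site 2)))
    (hW : ∀ e ∈ W, ∃ (v : Site 2) (d : Fin 2), e = edgeOf (v, d) ∧ ¬ ax k (v, d)) :
    ∑ e ∈ W, (bondPercolation (zdGraph 2) half).real {ω | IsPivotal (Aloc m F η) e ω} ≤
      Dc k m F η ((0 : ℝ), (1 / 2 : ℝ)) := by
  classical
  obtain ⟨K, hK⟩ := exists_coinFinset k m F hη
  -- Russo's formula for the increasing shadow event along `c ↦ prm k 0 c` at `c = ½`
  have hdet : DeterminedBy ((edgeConfig ∘ ownLayer) ⁻¹' Aloc m F η)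
      (↑K : Set (Site 2 × Fin 2 × Fin 3)) := by
    rw [hK]
    exact determinedBy_preimage_Aloc_shadow k m F η
  have hD := hasDerivAt_prodBernoulli_real (fun b => prm k 0 b)
    (isUpperSet_preimage_Aloc_shadow m F η) hdet (1 / 2)
    (fun i => if i.2.2 = 0 ∧ ¬ ax k (i.1, i.2.1) then (1 : ℝ) else 0)
    (fun i _ => hasDerivAt_coe_prm k i)
  have hPfun : (fun c' => P k m F η 0 c') =
      fun b => (prodBernoulli (prm k 0 b)).real ((edgeConfig ∘ ownLayer) ⁻¹' Aloc m F η) :=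
    funext fun c' => P_zero_eq_real_shadow k m F hη c'
  have hDc : Dc k m F η ((0 : ℝ), (1 / 2 : ℝ)) = ∑ i ∈ K,
      (if i.2.2 = 0 ∧ ¬ ax k (i.1, i.2.1) then (1 : ℝ) else 0) *
        (prodBernoulli (prm k 0 (1 / 2))).real
          {S | IsPivotal ((edgeConfig ∘ ownLayer) ⁻¹' Aloc m F η) i S} := by
    have hnhds : Set.Icc (0 : ℝ) 1 ∈ 𝓝 ((1 : ℝ) / 2) := Icc_mem_nhds (by norm_num) (by norm_num)
    show derivWithin (fun c' => P k m F η 0 c') (Set.Icc 0 1) (1 / 2) = _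
    rw [derivWithin_of_mem_nhds hnhds, hPfun]
    exact hD.deriv
  rw [hDc]
  simp only [ite_mul, one_mul, zero_mul]
  rw [← Finset.sum_filter]
  -- edges of `W` outside the window contribute nothing
  have hdrop : ∑ e ∈ W, (bondPercolation (zdGraph 2) half).real {ω | IsPivotal (Aloc m F η) e ω} =
      ∑ e ∈ W.filter (fun e => e ∈ window m F η),
        (bondPercolation (zdGraph 2) half).real {ω | IsPivotal (Aloc m F η) e ω} := by
    rw [Finset.sum_filter_of_ne]
    intro e _ hne
    by_contra hew
    exact hne (by rw [setOf_isPivotal_Aloc_eq_empty m F η hew, measureReal_empty])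
  rw [hdrop]
  -- reindex `W ∩ window` into the coin window by the own coin `e ↦ (v e, d e, 0)`
  choose! v d hvd using hW
  have hinj : Set.InjOn (fun e : Sym2 (Site 2) => (v e, d e, (0 : Fin 3)))
      (↑(W.filter (fun e => e ∈ window m F η)) : Set (Sym2 (Site 2))) := by
    intro e he e' he' h
    have heW : e ∈ W := (Finset.mem_filter.1 (Finset.mem_coe.1 he)).1
    have he'W : e' ∈ W := (Finset.mem_filter.1 (Finset.mem_coe.1 he')).1
    obtain ⟨h₁, h₂⟩ := Prod.mk.inj h
    have h₃ : d e = d e' := (Prod.mk.inj h₂).1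
    rw [(hvd e heW).1, (hvd e' he'W).1, h₁, h₃]
  have hsub : (W.filter (fun e => e ∈ window m F η)).image (fun e => (v e, d e, (0 : Fin 3))) ⊆
      K.filter (fun i => i.2.2 = 0 ∧ ¬ ax k (i.1, i.2.1)) := by
    intro i hi
    obtain ⟨e, he, rfl⟩ := Finset.mem_image.1 hi
    obtain ⟨heW, hew⟩ := Finset.mem_filter.1 he
    obtain ⟨hee, hax⟩ := hvd e heW
    rw [hee] at hew
    refine Finset.mem_filter.2 ⟨?_, rfl, hax⟩
    rw [← Finset.mem_coe, hK]
    exact own_mem_coinWindow k hew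
  calc ∑ e ∈ W.filter (fun e => e ∈ window m F η),
        (bondPercolation (zdGraph 2) half).real {ω | IsPivotal (Aloc m F η) e ω}
      = ∑ e ∈ W.filter (fun e => e ∈ window m F η),
          (prodBernoulli (prm k 0 (1 / 2))).real
            {S | IsPivotal ((edgeConfig ∘ ownLayer) ⁻¹' Aloc m F η) (v e, d e, (0 : Fin 3)) S} := by
        refine Finset.sum_congr rfl fun e he => ?_
        have heW : e ∈ W := (Finset.mem_filter.1 he).1
        rw [bondPercolation_half_eq_map_shadow k,
          map_measureReal_apply (measurable_edgeConfig.comp measurable_ownLayer)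
            (measurableSet_setOf_isPivotal (measurableSet_Aloc m F hη) e),
          ← preimage_setOf_isPivotal_Aloc m F η (v e) (d e), ← (hvd e heW).1]
    _ = ∑ i ∈ (W.filter (fun e => e ∈ window m F η)).image (fun e => (v e, d e, (0 : Fin 3))),
          (prodBernoulli (prm k 0 (1 / 2))).real
            {S | IsPivotal ((edgeConfig ∘ ownLayer) ⁻¹' Aloc m F η) i S} := by
        rw [Finset.sum_image hinj]
    _ ≤ ∑ i ∈ K.filter (fun i => i.2.2 = 0 ∧ ¬ ax k (i.1, i.2.1)),
          (prodBernoulli (prm k 0 (1 / 2))).real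
            {S | IsPivotal ((edgeConfig ∘ ownLayer) ⁻¹' Aloc m F η) i S} :=
        Finset.sum_le_sum_of_subset_of_nonneg hsub fun _ _ _ => measureReal_nonneg

end Summit.CriticalPhenomena.CardyFormulaZ2.Theorems.CardySelfRefinement

end
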